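/-
COR-CM (cells pub-hodgecm / pub-hodgecm2, stage 2 of the Hodge ladder) — junction B01, item (vi) S2 pinning lane: the (β)-FREE MEETING-FORM
TWINS of TEAM hCMisogE's Def. 4.5 (2) END DISPLAYS `Model.hc_cm_of_thm418AsPrinted_pinnedE_def45` (`Transposition/Item6SupplyPinnedDef45.lean`,
hcmisog-glue, p305040) and `Model.hc_cm_of_thm418AsPrinted_pinnedE_def45final` (`Transposition/Item6SupplyPinnedDef45Final.lean`, p305676) —
asked for by the red team (TGTBT DELTA 13, D13.3 item 1: «a (β)-free pinnedE/Def45 twin must be FILED before any Def45 display is quoted as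
the closing display»; ROW 54/67) under COORDINATOR RULING 2026-08-21T18:44:30Z «clause (β) RE-TYPED to the consumed form … (own-htheta)».
Seat prover-pub-hodgecm-own-htheta-g4-0 (own-htheta gen 4, owner of the item-(vi) lineage; rule-(1) blanket `Transposition/Item6*`, NAMING
pub-hodgecm2/INBOX with first refusal to hcmisog-glue / pin-2).  Kernel pre-certificate: htheta-x2 g6 probe `probe_x2_def45_meeting.lean`
d192e4c6c4e4 (rc 0, trio ×2, hodge-director/INBOX l.1240); the two theorem texts below are x2's appendix `x2/tools/appendix_d45m.lean`
757b72af992c with the namespace `X2D45M` replaced by `Summit.HodgeConjecture.CorCM.Model` — binder texts produced MECHANICALLY from the tree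
bytes (p301318 §1 block + p305040 :148–166 / p305676), not retyped.  Theorems only (two one-line compositions BY NAME): no `def`, no
instance, no named fact, nothing asserted, no `sorry`; no other lane's file is modified.
T5 (COORDINATOR RULING 2026-08-21T15:33:56Z (3)): CARRY class — the binder families are p301318's T5-checked family with `hCMisogE` ↦
{`i`, `hdim`, `hdet45`(, `hdetBC`, `hW`)} = the T5-checked families of p305040 / p305676 (T5-LEDGER l.57 and its carries) ∪ {`hM`}; the
line on these exact bytes is quoted in the filing note.
FRAMING: HC_CM is NOT proved; nothing below is an «S2 SUPPLY CLOSED» statement; every displayed hypothesis is OPEN and inhabited by no one.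
-/
import Summits.HodgeConjecture.CorCM.B01.Transposition.Item6SupplyPinnedDef45
import Summits.HodgeConjecture.CorCM.B01.Transposition.Item6SupplyPinnedDef45Final
import Summits.HodgeConjecture.CorCM.B01.FaceWedgeOverlapBypassMeetingPinned
import HarnessLib

/-!
# The Def. 4.5 (2) pinned end displays without `hD`: Def45 pin binders + `hM` ⇒ `HC_CM`

TEAM hCMisogE's END DISPLAYS `hc_cm_of_thm418AsPrinted_pinnedE_def45 (U) (hU) … (hComp) (hD)` (p305040 :182) and
`hc_cm_of_thm418AsPrinted_pinnedE_def45final … (hD)` (p305676 :180) compose their supply junctions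
(`faceSupply_of_thm418AsPrinted_pinnedE_def45[final] … : U.FaceSupply`, where the binder `hCMisogE` of the pinning lane is REPLACED by
[Liu 2021] Def. 4.5 (2) DATA readings {carrier `i`, `hdim`, `hdet45`} (+ {`hdetBC`, `hW`} in the first, both discharged BY NAME by the
tree theorems `AbelianVariety.det_cotangentMap_baseChange` / `cotangent_hodge10_comparison_holds` in the second)) with
`hc_cm_of_supply_of_dictionary_of_eq _ rfl … hD`, whose `hD` carries clause (β) `emb Γ' (cover^* x) = emb Γ x` VERBATIM — ruled
STRONGER-THAN-CONSUMED (tgtbt-1 D5.1) and FALSE at the tree's only model embedding `Model.embOf`.  THIS FILE composes the SAME two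
junctions BY NAME with the (β)-free meeting-form display of the x2 lane `hc_cm_of_supply_of_settingMeetSat_embOf`
(`CorCM/B01/FaceWedgeOverlapBypassMeeting.lean`, p295997), exactly as b01-x2's `FaceWedgeOverlapBypassMeetingPinned.lean` (p301318) does for
the `hCMisogE`-form junction:
* `hc_cm_of_thm418AsPrinted_pinnedE_def45_settingMeetSat_rec` — p305040's binders {`D`, `Aμ₀`, `AK`, `homE`, `hE`, `hLiu`, `hObj`, `hChi`,
  `hirr`, `hsm`, `hμ`, `i`, `hdim`, `hdet45`, `hdetBC`, `hW`, `hComp`} VERBATIM + `hM` (p301318 :71 binder VERBATIM: ONE isolation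
  setting per context over `Lp ℂ 2 V.autMeasure`, C5′ at saturated (12)-sets, C6′, at `U_rec` through `embOf`) ⇒ `HC_CM`;
* `hc_cm_of_thm418AsPrinted_pinnedE_def45final_settingMeetSat_rec` — the same over p305676's junction, − {`hdetBC`, `hW`}.
RESIDUAL BINDERS = EXACTLY those lists; no `HG/emb/cover`, no (α)(β)(γ), no `levelMeet`, no `TranslateClosed`.  Their classification is
the teams' and the red team's (TGTBT D10 row 56 / D13 rows 67–71; AUDIT-CITESCOPE D13; HM-EQUALITY §18): the CM side is Liu's printed
Def. 4.5 (2) data on `A_μ` read at `ι₁`, inhabited only by Liu's Prop. 4.6 (1) object; `hComp` = TEAM hComp's {hUnif, hAlb}; `hM` = B01-O.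
HC_CM is NOT proved: none of these hypotheses is inhabited; count-neutral, no row change.

References: Y. Liu, *Fourier–Jacobi cycles and arithmetic relative trace formula*, Camb. J. Math. 9 (2021) = arXiv:2102.11518, Def. 4.5
(`FJcycle.tex` l. 1936–1964), Prop. 4.6 (1) l. 1966–1969, Thm. 4.18 l. 2232–2245.
-/

noncomputable section

set_option autoImplicit false

open scoped TensorProduct InnerProductSpace

namespace Summit.HodgeConjecture.CorCM.Model

open CategoryTheory CategoryTheory.Limits AlgebraicGeometry NumberField MeasureTheory
open Literature.AlgebraicGeometry.Motives
open Literature.AlgebraicGeometry.ShimuraVarieties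
open Literature.AlgebraicGeometry.Motives.HodgeStructure (conj)
open Literature.AlgebraicGeometry.HodgeTheory
open Literature.AlgebraicGeometry.ComplexMultiplication (IsCMTypeRealisation)
open Literature.NumberTheory.ComplexMultiplication
open Literature.NumberTheory.Automorphic
open Literature.NumberTheory.Automorphic.IdeleClassGroup
open Literature.NumberTheory.Automorphic.PicardCM
open Literature.NumberTheory.Automorphic.Liu2021
open Prior.Perl34File (Perl34.IsolationSetting)
open Prior.Perl34File.Perl34

/-! ## §1  Def45 pin binders (p305040's seventeen) + `hM` -/

/-- **Def. 4.5 (2) PINNED END DISPLAY, (β)-FREE, SATURATED MEETING FORM, on the universe OF RECORD** (`exists_isReal_hodgeModel_holds`,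
`hodgePQ_independent_of_hodgeModel_holds`, `BallQuotient.ballQuotientUniformised_holds`, `cmAbelianVarietyRealised_holds`,
`deligneMilne1982_Thm_6_20_full_holds` plugged in): TEAM hCMisogE's supply junction `faceSupply_of_thm418AsPrinted_pinnedE_def45`
(p305040; its seventeen binders VERBATIM, in its order — the pinning lane's binders with `hCMisogE` replaced by [Liu 2021] Def. 4.5 (2)
data readings `i`/`hdim`/`hdet45` + the two standard facts `hdetBC`/`hW`) composed BY NAME with `hc_cm_of_supply_of_settingMeetSat_embOf`
(`FaceWedgeOverlapBypassMeeting.lean`; binder `hM` VERBATIM at `U_rec`).  Displayed hypotheses = EXACTLY the seventeen + `hM`; compare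
`hc_cm_of_thm418AsPrinted_pinnedE_def45 _ rfl … hD` (p305040 :182): no `HG/emb/cover`, no (α)(β)(γ).  HC_CM is NOT proved: none is
inhabited. [cite: Liu2021, Def. 4.5 (2) (FJcycle.tex l. 1944–1951), Thm. 4.18 (l. 2232–2245)] -/
theorem hc_cm_of_thm418AsPrinted_pinnedE_def45_settingMeetSat_rec
    (D : ∀ (F : CMField) (ι₁ : F →+* ℂ) (_ : HermSpace3 F ι₁) (_ : CMType F), Thm418Data (maximalRealSubfield F) F)
    (Aμ₀ : ∀ (F : CMField) (ι₁ : F →+* ℂ) (V : HermSpace3 F ι₁) (Φ : CMType F), (D F ι₁ V Φ).Obj → AbelianVariety F)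
    (AK : ∀ (F : CMField) (ι₁ : F →+* ℂ) (V : HermSpace3 F ι₁) (Φ : CMType F), Subgroup (D F ι₁ V Φ).G → AbelianVariety F)
    (homE : ∀ (F : CMField) (ι₁ : F →+* ℂ) (V : HermSpace3 F ι₁) (Φ : CMType F) (K : Subgroup (D F ι₁ V Φ).G)
      (Dμ : (D F ι₁ V Φ).Obj), (D F ι₁ V Φ).HomK K Dμ →+ ℚ ⊗[ℤ] (AK F ι₁ V Φ K ⟶ Aμ₀ F ι₁ V Φ Dμ))
    (hE : ∀ (F : CMField) (ι₁ : F →+* ℂ) (V : HermSpace3 F ι₁) (Φ : CMType F) (K : Subgroup (D F ι₁ V Φ).G)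
      (Dμ : (D F ι₁ V Φ).Obj), Function.Injective (homE F ι₁ V Φ K Dμ))
    (hLiu : ∀ (F : CMField), IsGalois ℚ F → 6 ≤ Module.finrank ℚ F → ∀ (Φ : CMType F) (ι₁ : F →+* ℂ), ι₁ ∈ Φ.1 →
      ∀ V : HermSpace3 F ι₁, Thm418AsPrinted (D F ι₁ V Φ))
    (hObj : ∀ (F : CMField), IsGalois ℚ F → 6 ≤ Module.finrank ℚ F → ∀ (Φ : CMType F) (ι₁ : F →+* ℂ), ι₁ ∈ Φ.1 →
      ∀ V : HermSpace3 F ι₁, Nonempty (D F ι₁ V Φ).Obj)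
    (hChi : ∀ (F : CMField), IsGalois ℚ F → 6 ≤ Module.finrank ℚ F → ∀ (Φ : CMType F) (ι₁ : F →+* ℂ), ι₁ ∈ Φ.1 →
      ∀ V : HermSpace3 F ι₁, Nonempty (D F ι₁ V Φ).Chi)
    (hirr : ∀ (F : CMField), IsGalois ℚ F → 6 ≤ Module.finrank ℚ F → ∀ (Φ : CMType F) (ι₁ : F →+* ℂ), ι₁ ∈ Φ.1 →
      ∀ (V : HermSpace3 F ι₁) (i : (D F ι₁ V Φ).AdmIndex), ((D F ι₁ V Φ).rhoAt i).IsIrreducible)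
    (hsm : ∀ (F : CMField), IsGalois ℚ F → 6 ≤ Module.finrank ℚ F → ∀ (Φ : CMType F) (ι₁ : F →+* ℂ), ι₁ ∈ Φ.1 →
      ∀ (V : HermSpace3 F ι₁) (i : (D F ι₁ V Φ).AdmIndex) (v : (D F ι₁ V Φ).omegaAt i),
        ∃ S : Subgroup (D F ι₁ V Φ).G, IsOpen (S : Set (D F ι₁ V Φ).G) ∧ ∀ k ∈ S, (D F ι₁ V Φ).rhoAt i k v = v)
    (hμ : ∀ (F : CMField), IsGalois ℚ F → 6 ≤ Module.finrank ℚ F → ∀ (Φ : CMType F) (ι₁ : F →+* ℂ), ι₁ ∈ Φ.1 →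
      ∀ (V : HermSpace3 F ι₁) (g : F ≃ₐ[ℚ] F),
        ι₁.comp (g : F →+* F) ∈ (D F ι₁ V Φ).cmType.1 ↔ ι₁.comp (g.symm : F →+* F) ∈ Φ.1)
    (i : ∀ (F : CMField) (ι₁ : F →+* ℂ) (V : HermSpace3 F ι₁) (Φ : CMType F) (Dμ : (D F ι₁ V Φ).Obj),
      muAlgValueField F (D F ι₁ V Φ).μ →+* (Aμ₀ F ι₁ V Φ Dμ).endAlgebra)
    (hdim : ∀ (F : CMField) [IsGalois ℚ F], 6 ≤ Module.finrank ℚ F → ∀ (Φ : CMType F) (ι₁ : F →+* ℂ), ι₁ ∈ Φ.1 →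
      ∀ (V : HermSpace3 F ι₁) (Dμ : (D F ι₁ V Φ).Obj),
        Module.finrank ℚ (muAlgValueField F (D F ι₁ V Φ).μ) = 2 * (Aμ₀ F ι₁ V Φ Dμ).dim)
    (hdet45 : ∀ (F : CMField) [IsGalois ℚ F], 6 ≤ Module.finrank ℚ F → ∀ (Φ : CMType F) (ι₁ : F →+* ℂ), ι₁ ∈ Φ.1 →
      ∀ (V : HermSpace3 F ι₁) (Dμ : (D F ι₁ V Φ).Obj) (x : muAlgValueField F (D F ι₁ V Φ).μ) (M : ℕ)
        (f : End (Aμ₀ F ι₁ V Φ Dμ)), M ≠ 0 →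
        i F ι₁ V Φ Dμ x =
          algebraMap ℚ (Aμ₀ F ι₁ V Φ Dμ).endAlgebra (M : ℚ)⁻¹ * AbelianVariety.endAlgebra.of (Aμ₀ F ι₁ V Φ Dμ) f →
        LinearMap.det (AbelianVariety.cotangentMap (Aμ₀ F ι₁ V Φ Dμ) f) =
          (M : F) ^ (Aμ₀ F ι₁ V Φ Dμ).dim * Def45.eta (AlgHom.id ℚ F) ι₁ (D F ι₁ V Φ).isConjugateSymplectic x)
    (hdetBC : ∀ (K : Type) [Field K] (L : Type) [Field L] [Algebra K L] (A : AbelianVariety K) (u : A ⟶ A),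
      LinearMap.det (AbelianVariety.cotangentMap (A.baseChange L) (AbelianVariety.Hom.baseChange L u)) =
        algebraMap K L (LinearMap.det (AbelianVariety.cotangentMap A u)))
    (hW : cotangent_hodge10_comparison)
    (hComp : ∀ (F : CMField), IsGalois ℚ F → 6 ≤ Module.finrank ℚ F → ∀ (Φ : CMType F) (ι₁ : F →+* ℂ), ι₁ ∈ Φ.1 →
      ∀ V : HermSpace3 F ι₁, ∃ Ksm : Subgroup (D F ι₁ V Φ).G, IsOpenCompact Ksm ∧
        ∀ K : Subgroup (D F ι₁ V Φ).G, IsOpenCompact K → K ≤ Ksm →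
          ∃ (C : Type) (_ : Fintype C) (X : C → SchemeOver ℂ) (B : ∀ c, UnitaryBallUniformisationDatum 2 (X c))
            (Γ : C → Level V) (𝒥 : ∀ c, Jacobian (X c))
            (π : ∀ c, (letI := ι₁.toAlgebra; (AK F ι₁ V Φ K).baseChange ℂ) ⟶ (𝒥 c).J),
            (∀ c, (B c).Hℂ = V.Hm.map ι₁) ∧
            (∀ c, (B c).Γ.map (Matrix.GeneralLinearGroup.map (B c).τ₁) =
              (Γ c).Γ.map (Matrix.GeneralLinearGroup.map ι₁)) ∧
            Nonempty (IsLimit (Fan.mk (letI := ι₁.toAlgebra; (AK F ι₁ V Φ K).baseChange ℂ) π))) :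
    let U := picardCMUniverse exists_isReal_hodgeModel_holds hodgePQ_independent_of_hodgeModel_holds
      BallQuotient.ballQuotientUniformised_holds cmAbelianVarietyRealised_holds
    let hU := ballQuotientUniformisedDatum_of BallQuotient.ballQuotientUniformised_holds
    (∀ (F : CMField), IsGalois ℚ F → 6 ≤ Module.finrank ℚ F → ∀ (f : Face F) (ι₁ : F →+* ℂ), f.Admissible ι₁ →
      ∀ V : HermSpace3 F ι₁,
      ∃ (H CG G SK SigIdx SigIdxG : Type) (_ : NormedAddCommGroup H) (_ : InnerProductSpace ℂ H) (_ : CompleteSpace H)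
        (_ : NormedAddCommGroup CG) (_ : NormedSpace ℂ CG) (_ : Group G) (_ : TopologicalSpace G) (_ : TopologicalSpace SK)
        (S : Perl34.IsolationSetting H (Lp ℂ 2 V.autMeasure) CG G SK SigIdx SigIdxG),
        (∀ (Γ : Level V) (ω₁ ω₂ : U.CohC (U.pms F ι₁ V Γ) 1),
          ω₁ ∈ U.Uiso Γ F (f.psi 0) ι₁ → ω₂ ∈ U.Uiso Γ F (f.psi 1) ι₁ →
            embOf exists_isReal_hodgeModel_holds hodgePQ_independent_of_hodgeModel_holds hU cmAbelianVarietyRealised_holds Γ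
                (U.cup2C (U.pms F ι₁ V Γ) 1 ω₁ ω₂) ≠ 0 →
              ∃ u ∈ S.t12.S12,
                ⟪embOf exists_isReal_hodgeModel_holds hodgePQ_independent_of_hodgeModel_holds hU cmAbelianVarietyRealised_holds Γ
                    (U.cup2C (U.pms F ι₁ V Γ) 1 ω₁ ω₂), u⟫_ℂ ≠ 0) ∧
        (∀ χ : S.t34.X, S.t34.allowed χ → ∀ (Φ : SK) (Γ₁ : Level V)
          (ω₁ ω₂ : U.CohC (U.pms F ι₁ V Γ₁) 1),
          ω₁ ∈ U.Uiso Γ₁ F (f.psi 0) ι₁ →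
          ω₂ ∈ U.Uiso Γ₁ F (f.psi 1) ι₁ →
            ⟪embOf exists_isReal_hodgeModel_holds hodgePQ_independent_of_hodgeModel_holds hU cmAbelianVarietyRealised_holds Γ₁
                (U.cup2C (U.pms F ι₁ V Γ₁) 1 ω₁ ω₂),
              S.t34.ϑ χ Φ⟫_ℂ ≠ 0 →
              ∃ (Γ : Level V) (ω : Fin 4 → U.CohC (U.pms F ι₁ V Γ) 1),
                (∀ i, ω i ∈ U.Uiso Γ F (f.psi i) ι₁) ∧
                  ⟪embOf exists_isReal_hodgeModel_holds hodgePQ_independent_of_hodgeModel_holds hU cmAbelianVarietyRealised_holds Γ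
                      (U.cup2C (U.pms F ι₁ V Γ) 1 (ω 2) (ω 3)),
                    embOf exists_isReal_hodgeModel_holds hodgePQ_independent_of_hodgeModel_holds hU cmAbelianVarietyRealised_holds Γ
                      (U.cup2C (U.pms F ι₁ V Γ) 1 (ω 0) (ω 1))⟫_ℂ
                    ≠ 0)) →
    HC_CM :=
  fun hM ↦ hc_cm_of_supply_of_settingMeetSat_embOf exists_isReal_hodgeModel_holds hodgePQ_independent_of_hodgeModel_holds
    BallQuotient.ballQuotientUniformised_holds cmAbelianVarietyRealised_holds deligneMilne1982_Thm_6_20_full_holds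
    (faceSupply_of_thm418AsPrinted_pinnedE_def45 _ _ _ _ D Aμ₀ AK homE hE hLiu hObj hChi hirr hsm hμ i hdim hdet45 hdetBC hW hComp) hM

/-! ## §2  Def45-final pin binders (p305676's fifteen: − {`hdetBC`, `hW`}) + `hM` -/

/-- **Def. 4.5 (2) PINNED END DISPLAY OF TEAM hCMisogE's FORM OF RECORD (p305676: `hdetBC`/`hW` discharged inside the junction by the tree
theorems `AbelianVariety.det_cotangentMap_baseChange` / `cotangent_hodge10_comparison_holds`), (β)-FREE, SATURATED MEETING FORM, on the
universe OF RECORD**: `faceSupply_of_thm418AsPrinted_pinnedE_def45final` (its fifteen binders VERBATIM, in its order) composed BY NAME with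
`hc_cm_of_supply_of_settingMeetSat_embOf` (binder `hM` VERBATIM at `U_rec`).  Displayed hypotheses = EXACTLY the fifteen + `hM`; compare
`hc_cm_of_thm418AsPrinted_pinnedE_def45final _ rfl … hD` (p305676 :180): no `HG/emb/cover`, no (α)(β)(γ).  HC_CM is NOT proved: none is
inhabited. [cite: Liu2021, Def. 4.5 (2) (FJcycle.tex l. 1944–1951), Thm. 4.18 (l. 2232–2245)] -/
theorem hc_cm_of_thm418AsPrinted_pinnedE_def45final_settingMeetSat_rec
    (D : ∀ (F : CMField) (ι₁ : F →+* ℂ) (_ : HermSpace3 F ι₁) (_ : CMType F), Thm418Data (maximalRealSubfield F) F)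
    (Aμ₀ : ∀ (F : CMField) (ι₁ : F →+* ℂ) (V : HermSpace3 F ι₁) (Φ : CMType F), (D F ι₁ V Φ).Obj → AbelianVariety F)
    (AK : ∀ (F : CMField) (ι₁ : F →+* ℂ) (V : HermSpace3 F ι₁) (Φ : CMType F), Subgroup (D F ι₁ V Φ).G → AbelianVariety F)
    (homE : ∀ (F : CMField) (ι₁ : F →+* ℂ) (V : HermSpace3 F ι₁) (Φ : CMType F) (K : Subgroup (D F ι₁ V Φ).G)
      (Dμ : (D F ι₁ V Φ).Obj), (D F ι₁ V Φ).HomK K Dμ →+ ℚ ⊗[ℤ] (AK F ι₁ V Φ K ⟶ Aμ₀ F ι₁ V Φ Dμ))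
    (hE : ∀ (F : CMField) (ι₁ : F →+* ℂ) (V : HermSpace3 F ι₁) (Φ : CMType F) (K : Subgroup (D F ι₁ V Φ).G)
      (Dμ : (D F ι₁ V Φ).Obj), Function.Injective (homE F ι₁ V Φ K Dμ))
    (hLiu : ∀ (F : CMField), IsGalois ℚ F → 6 ≤ Module.finrank ℚ F → ∀ (Φ : CMType F) (ι₁ : F →+* ℂ), ι₁ ∈ Φ.1 →
      ∀ V : HermSpace3 F ι₁, Thm418AsPrinted (D F ι₁ V Φ))
    (hObj : ∀ (F : CMField), IsGalois ℚ F → 6 ≤ Module.finrank ℚ F → ∀ (Φ : CMType F) (ι₁ : F →+* ℂ), ι₁ ∈ Φ.1 →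
      ∀ V : HermSpace3 F ι₁, Nonempty (D F ι₁ V Φ).Obj)
    (hChi : ∀ (F : CMField), IsGalois ℚ F → 6 ≤ Module.finrank ℚ F → ∀ (Φ : CMType F) (ι₁ : F →+* ℂ), ι₁ ∈ Φ.1 →
      ∀ V : HermSpace3 F ι₁, Nonempty (D F ι₁ V Φ).Chi)
    (hirr : ∀ (F : CMField), IsGalois ℚ F → 6 ≤ Module.finrank ℚ F → ∀ (Φ : CMType F) (ι₁ : F →+* ℂ), ι₁ ∈ Φ.1 →
      ∀ (V : HermSpace3 F ι₁) (i : (D F ι₁ V Φ).AdmIndex), ((D F ι₁ V Φ).rhoAt i).IsIrreducible)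
    (hsm : ∀ (F : CMField), IsGalois ℚ F → 6 ≤ Module.finrank ℚ F → ∀ (Φ : CMType F) (ι₁ : F →+* ℂ), ι₁ ∈ Φ.1 →
      ∀ (V : HermSpace3 F ι₁) (i : (D F ι₁ V Φ).AdmIndex) (v : (D F ι₁ V Φ).omegaAt i),
        ∃ S : Subgroup (D F ι₁ V Φ).G, IsOpen (S : Set (D F ι₁ V Φ).G) ∧ ∀ k ∈ S, (D F ι₁ V Φ).rhoAt i k v = v)
    (hμ : ∀ (F : CMField), IsGalois ℚ F → 6 ≤ Module.finrank ℚ F → ∀ (Φ : CMType F) (ι₁ : F →+* ℂ), ι₁ ∈ Φ.1 →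
      ∀ (V : HermSpace3 F ι₁) (g : F ≃ₐ[ℚ] F),
        ι₁.comp (g : F →+* F) ∈ (D F ι₁ V Φ).cmType.1 ↔ ι₁.comp (g.symm : F →+* F) ∈ Φ.1)
    (i : ∀ (F : CMField) (ι₁ : F →+* ℂ) (V : HermSpace3 F ι₁) (Φ : CMType F) (Dμ : (D F ι₁ V Φ).Obj),
      muAlgValueField F (D F ι₁ V Φ).μ →+* (Aμ₀ F ι₁ V Φ Dμ).endAlgebra)
    (hdim : ∀ (F : CMField) [IsGalois ℚ F], 6 ≤ Module.finrank ℚ F → ∀ (Φ : CMType F) (ι₁ : F →+* ℂ), ι₁ ∈ Φ.1 →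
      ∀ (V : HermSpace3 F ι₁) (Dμ : (D F ι₁ V Φ).Obj),
        Module.finrank ℚ (muAlgValueField F (D F ι₁ V Φ).μ) = 2 * (Aμ₀ F ι₁ V Φ Dμ).dim)
    (hdet45 : ∀ (F : CMField) [IsGalois ℚ F], 6 ≤ Module.finrank ℚ F → ∀ (Φ : CMType F) (ι₁ : F →+* ℂ), ι₁ ∈ Φ.1 →
      ∀ (V : HermSpace3 F ι₁) (Dμ : (D F ι₁ V Φ).Obj) (x : muAlgValueField F (D F ι₁ V Φ).μ) (M : ℕ)
        (f : End (Aμ₀ F ι₁ V Φ Dμ)), M ≠ 0 →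
        i F ι₁ V Φ Dμ x =
          algebraMap ℚ (Aμ₀ F ι₁ V Φ Dμ).endAlgebra (M : ℚ)⁻¹ * AbelianVariety.endAlgebra.of (Aμ₀ F ι₁ V Φ Dμ) f →
        LinearMap.det (AbelianVariety.cotangentMap (Aμ₀ F ι₁ V Φ Dμ) f) =
          (M : F) ^ (Aμ₀ F ι₁ V Φ Dμ).dim * Def45.eta (AlgHom.id ℚ F) ι₁ (D F ι₁ V Φ).isConjugateSymplectic x)
    (hComp : ∀ (F : CMField), IsGalois ℚ F → 6 ≤ Module.finrank ℚ F → ∀ (Φ : CMType F) (ι₁ : F →+* ℂ), ι₁ ∈ Φ.1 →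
      ∀ V : HermSpace3 F ι₁, ∃ Ksm : Subgroup (D F ι₁ V Φ).G, IsOpenCompact Ksm ∧
        ∀ K : Subgroup (D F ι₁ V Φ).G, IsOpenCompact K → K ≤ Ksm →
          ∃ (C : Type) (_ : Fintype C) (X : C → SchemeOver ℂ) (B : ∀ c, UnitaryBallUniformisationDatum 2 (X c))
            (Γ : C → Level V) (𝒥 : ∀ c, Jacobian (X c))
            (π : ∀ c, (letI := ι₁.toAlgebra; (AK F ι₁ V Φ K).baseChange ℂ) ⟶ (𝒥 c).J),
            (∀ c, (B c).Hℂ = V.Hm.map ι₁) ∧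
            (∀ c, (B c).Γ.map (Matrix.GeneralLinearGroup.map (B c).τ₁) =
              (Γ c).Γ.map (Matrix.GeneralLinearGroup.map ι₁)) ∧
            Nonempty (IsLimit (Fan.mk (letI := ι₁.toAlgebra; (AK F ι₁ V Φ K).baseChange ℂ) π))) :
    let U := picardCMUniverse exists_isReal_hodgeModel_holds hodgePQ_independent_of_hodgeModel_holds
      BallQuotient.ballQuotientUniformised_holds cmAbelianVarietyRealised_holds
    let hU := ballQuotientUniformisedDatum_of BallQuotient.ballQuotientUniformised_holds
    (∀ (F : CMField), IsGalois ℚ F → 6 ≤ Module.finrank ℚ F → ∀ (f : Face F) (ι₁ : F →+* ℂ), f.Admissible ι₁ →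
      ∀ V : HermSpace3 F ι₁,
      ∃ (H CG G SK SigIdx SigIdxG : Type) (_ : NormedAddCommGroup H) (_ : InnerProductSpace ℂ H) (_ : CompleteSpace H)
        (_ : NormedAddCommGroup CG) (_ : NormedSpace ℂ CG) (_ : Group G) (_ : TopologicalSpace G) (_ : TopologicalSpace SK)
        (S : Perl34.IsolationSetting H (Lp ℂ 2 V.autMeasure) CG G SK SigIdx SigIdxG),
        (∀ (Γ : Level V) (ω₁ ω₂ : U.CohC (U.pms F ι₁ V Γ) 1),
          ω₁ ∈ U.Uiso Γ F (f.psi 0) ι₁ → ω₂ ∈ U.Uiso Γ F (f.psi 1) ι₁ →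
            embOf exists_isReal_hodgeModel_holds hodgePQ_independent_of_hodgeModel_holds hU cmAbelianVarietyRealised_holds Γ
                (U.cup2C (U.pms F ι₁ V Γ) 1 ω₁ ω₂) ≠ 0 →
              ∃ u ∈ S.t12.S12,
                ⟪embOf exists_isReal_hodgeModel_holds hodgePQ_independent_of_hodgeModel_holds hU cmAbelianVarietyRealised_holds Γ
                    (U.cup2C (U.pms F ι₁ V Γ) 1 ω₁ ω₂), u⟫_ℂ ≠ 0) ∧
        (∀ χ : S.t34.X, S.t34.allowed χ → ∀ (Φ : SK) (Γ₁ : Level V)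
          (ω₁ ω₂ : U.CohC (U.pms F ι₁ V Γ₁) 1),
          ω₁ ∈ U.Uiso Γ₁ F (f.psi 0) ι₁ →
          ω₂ ∈ U.Uiso Γ₁ F (f.psi 1) ι₁ →
            ⟪embOf exists_isReal_hodgeModel_holds hodgePQ_independent_of_hodgeModel_holds hU cmAbelianVarietyRealised_holds Γ₁
                (U.cup2C (U.pms F ι₁ V Γ₁) 1 ω₁ ω₂),
              S.t34.ϑ χ Φ⟫_ℂ ≠ 0 →
              ∃ (Γ : Level V) (ω : Fin 4 → U.CohC (U.pms F ι₁ V Γ) 1),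
                (∀ i, ω i ∈ U.Uiso Γ F (f.psi i) ι₁) ∧
                  ⟪embOf exists_isReal_hodgeModel_holds hodgePQ_independent_of_hodgeModel_holds hU cmAbelianVarietyRealised_holds Γ
                      (U.cup2C (U.pms F ι₁ V Γ) 1 (ω 2) (ω 3)),
                    embOf exists_isReal_hodgeModel_holds hodgePQ_independent_of_hodgeModel_holds hU cmAbelianVarietyRealised_holds Γ
                      (U.cup2C (U.pms F ι₁ V Γ) 1 (ω 0) (ω 1))⟫_ℂ
                    ≠ 0)) →
    HC_CM :=
  fun hM ↦ hc_cm_of_supply_of_settingMeetSat_embOf exists_isReal_hodgeModel_holds hodgePQ_independent_of_hodgeModel_holds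
    BallQuotient.ballQuotientUniformised_holds cmAbelianVarietyRealised_holds deligneMilne1982_Thm_6_20_full_holds
    (faceSupply_of_thm418AsPrinted_pinnedE_def45final _ _ _ _ D Aμ₀ AK homE hE hLiu hObj hChi hirr hsm hμ i hdim hdet45 hComp) hM

end Summit.HodgeConjecture.CorCM.Model

end

#print axioms Summit.HodgeConjecture.CorCM.Model.hc_cm_of_thm418AsPrinted_pinnedE_def45_settingMeetSat_rec
#print axioms Summit.HodgeConjecture.CorCM.Model.hc_cm_of_thm418AsPrinted_pinnedE_def45final_settingMeetSat_rec
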